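import Summits.Ventures.HSemireg.WedgeBoxPerQ
import Summits.Ventures.HSemireg.WedgeBoxCount
import Summits.Ventures.HSemireg.FormulaNUniformBlocks

/-!
# Venture HSemireg — the PER-`q` (Dolbeault-block) ranks of the box in th-7's wedge model, 2/2: the COUNT
# `|reach n k q| = [t^k u^q] Q_n(t,u)²` (Künneth factorisation) and th-6's PER-q LAW as a kernel theorem for every `n ≥ 1`, `k ≥ 1`

HONEST FRAMING. Part of the Lean index of the computation cell `pub-hsemireg` (seat p10 gen 2, Sunday typer «UNIFORM-IN-n»).
Finite-dimensional EXTERIOR ALGEBRA and finite combinatorics over a field ONLY: no variety, no cohomology theory, no sheaf, no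
semiregularity map is constructed here; nothing here says that HC / HC_CM / HC_AV holds; no Literature fact is declared or used.

File 1/2 (`WedgeBoxPerQ.lean`) proved: for `n ≥ 1`, `k ≥ 1` and a box class with all four coefficients non-zero, the rank of the
`q`-block projection of `θ ↦ θ ∧ box` on `⋀^k K^{4n}` is the number `|reach n k q|` of monomials `T`, `|T| = k + 2n`, with
`qdeg T = |(X ∪ X′) ∖ T| = q` and `T ⊇ Aα ∪ Cβ` for some `α, β`.  Here:
* §1 the ONE-FACTOR COUNT (`card_factorReach`): for two disjoint blocks `B₀, B₁` of size `n` (on factor 1: `X, Y`; on factor 2: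
  `X′, Y′`) the subsets `T₁ ⊆ B₀ ∪ B₁` with `|T₁| = i + n`, `|B₀ ∖ T₁| = q₁`, containing `B₀` or `B₁`, number
  `qAtom n i q₁ = C(n,i)·([q₁ = 0] + [i < n ∧ q₁ = n − i])` = `[tⁱ u^{q₁}] Q_n(t,u)` (`FormulaNUniformBlocks.coeff_Q`) — th-6's
  u-refined point atom: `B₀ ∪ S` (`S ⊆ B₁`, GLOBAL, `q₁ = 0`) or `S ∪ B₁` (`S ⊆ B₀`, LOCAL, `q₁ = n − i`), the two families meeting
  only in `B₀ ∪ B₁` (`i = n`: the top collapse);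
* §2 the KÜNNETH FACTORISATION (`card_reach`): `T ↦ (T ∩ (X ∪ Y), T ∩ (X′ ∪ Y′))` is a bijection from `reach n k q` onto
  `⊔_{i+j=k, q₁+q₂=q} factorReach₁(i,q₁) × factorReach₂(j,q₂)`, so `|reach n k q| = Σ_{i+j=k} Σ_{q₁+q₂=q} qAtom n i q₁ · qAtom n j q₂
  = blockCount n k q = [t^k u^q] Q_n(t,u)²` (`FormulaNUniformBlocks.coeff_Q_sq`);
* §3 **th-6's PER-q LAW in the model** (`finrank_range_blockProj_wedgeMap`, `…_fac_mul`, `…_eq_coeff_Q_sq`): for every field `K`,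
  every `n ≥ 1`, `k ≥ 1`, `q`, and factor coefficients `a, a′` with non-zero entries,
      `rank(blockProj q ∘ (θ ↦ θ ∧ (f₁ ∧ f₂)) ∣ ⋀^k K^{4n}) = blockCount n k q = [t^k u^q] Q_n(t,u)²`
  — FORMULA-N PART A §4.1″ «Σ_{m ≥ 1, q} rank(σ_q ∣ Ext^m(G_n,G_n)) t^m u^q = Q_n(t,u)² (terms with m ≥ 1)», CLASS SIDE, with the
  `m ≥ 1` restriction appearing for the reason th-6 gives (`θ = 1` has two `q`-components in one block);
* §4 degree 2 = STRUCTURE C13: for `n ≥ 3` the block rank in degree 2 is `sigmaBlockRank n q` of `FormulaNUniform.lean` (1/3) —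
  `(2n² − n, n² − n, 2n², n² − n, 2n² − n)` at `q = (0, n−2, n−1, n, 2n−2)`, `0` elsewhere — now a KERNEL RANK THEOREM uniform in `n`
  (`finrank_range_blockProj_two_eq_sigmaBlockRank`); and the `n = 2, 3, 4` instances `(6,8,6)`, `(15,6,18,6,15)`,
  `(28,0,12,32,12,0,28)` (STEP-0's signed `(6,8,6)`; engine-1's `(15,6,18,6,15)` «MEASURED = PREDICTED TO THE DIGIT»).
DICTIONARY (quoted, NOT asserted; th-6 §2.3/§4.1″, th-7 PART B §A.3/§C.1): `blockProj q` ↔ the projection of `⊕_q H^{q+m}(Ω^q_Y)`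
onto its `q`-th summand, `θ ↦ θ ∧ (f₁ ∧ f₂)` ↔ `⌟ch(F₁ ⊠ F₂) = σ ∘ ev` ([BF08] Thm 6.4.2, on paper); when `ev` is onto (saturation,
(S2)) the block ranks of `σ` on `Ext^m` are these numbers.  Block ranks are NOT additive in `q` (`FormulaNUniformBlocks.sum_blockCount`:
`Σ_q = R_m + 2 r_m`) and NOT Fourier–Mukai / twist invariants (STRUCTURE D5).
-/

open Module Set Set.powersetCard Finset

namespace Summit.Ventures.HSemireg.WedgeBox

open Summit.Ventures.HSemireg.FormulaN.Uniform (qAtom blockCount)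

/-! ## §1. One factor: the u-refined point atom counts the factor-reachable sets -/

section FactorCount

variable {ι : Type*} [DecidableEq ι]

/-- the factor-reachable sets of two blocks `B₀` («`X`», local directions) and `B₁` («`Y`», global): `T ⊆ B₀ ∪ B₁`,
`|T| = i + n`, `|B₀ ∖ T| = q₁`, and `T ⊇ B₀` or `T ⊇ B₁`. -/
def factorReach (B₀ B₁ : Finset ι) (n i q₁ : ℕ) : Finset (Finset ι) :=
  (B₀ ∪ B₁).powerset.filter fun T => T.card = i + n ∧ (B₀ \ T).card = q₁ ∧ (B₀ ⊆ T ∨ B₁ ⊆ T)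

variable {B₀ B₁ : Finset ι} {n : ℕ}

/-- membership in `factorReach`. -/
lemma mem_factorReach {i q₁ : ℕ} {T : Finset ι} :
    T ∈ factorReach B₀ B₁ n i q₁ ↔ T ⊆ B₀ ∪ B₁ ∧ T.card = i + n ∧ (B₀ \ T).card = q₁ ∧ (B₀ ⊆ T ∨ B₁ ⊆ T) := by
  simp only [factorReach, Finset.mem_filter, Finset.mem_powerset]

/-- block `q₁ = 0` (GLOBAL components): `factorReach = {B₀ ∪ S : S ⊆ B₁, |S| = i}`. -/
lemma factorReach_zero (hd : Disjoint B₀ B₁) (h0 : B₀.card = n) (i : ℕ) :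
    factorReach B₀ B₁ n i 0 = (B₁.powersetCard i).image fun S => B₀ ∪ S := by
  ext T
  rw [mem_factorReach, Finset.mem_image]
  constructor
  · rintro ⟨hsub, hcard, hq, -⟩
    have hB : B₀ ⊆ T := Finset.sdiff_eq_empty_iff_subset.mp (Finset.card_eq_zero.mp hq)
    refine ⟨T \ B₀, Finset.mem_powersetCard.mpr ⟨?_, ?_⟩, Finset.union_sdiff_of_subset hB⟩
    · intro x hx
      rw [Finset.mem_sdiff] at hx
      rcases Finset.mem_union.mp (hsub hx.1) with h | h
      · exact (hx.2 h).elim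
      · exact h
    · rw [Finset.card_sdiff_of_subset hB, hcard, h0]; omega
  · rintro ⟨S, hS, rfl⟩
    rw [Finset.mem_powersetCard] at hS
    have hdS : Disjoint B₀ S := hd.mono_right hS.1
    refine ⟨Finset.union_subset_union (subset_refl _) hS.1, ?_, ?_, Or.inl Finset.subset_union_left⟩
    · rw [Finset.card_union_of_disjoint hdS, h0, hS.2]; omega
    · rw [Finset.card_eq_zero, Finset.sdiff_eq_empty_iff_subset]; exact Finset.subset_union_left

/-- block `q₁ > 0` (LOCAL components): `factorReach = {S ∪ B₁ : S ⊆ B₀, |S| = i}` if `i < n` and `q₁ = n − i`, else `∅`. -/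
lemma factorReach_pos (hd : Disjoint B₀ B₁) (h0 : B₀.card = n) (h1 : B₁.card = n) {q₁ : ℕ} (hq : 0 < q₁) (i : ℕ) :
    factorReach B₀ B₁ n i q₁ =
      if i < n ∧ q₁ = n - i then (B₀.powersetCard i).image (fun S => S ∪ B₁) else ∅ := by
  ext T
  rw [mem_factorReach]
  constructor
  · rintro ⟨hsub, hcard, hq1, hB⟩
    have hB0 : ¬ B₀ ⊆ T := fun h => by
      rw [Finset.sdiff_eq_empty_iff_subset.mpr h, Finset.card_empty] at hq1; omega
    have hB1 : B₁ ⊆ T := hB.resolve_left hB0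
    -- `S = T ∩ B₀`, `T = S ∪ B₁`
    have hT : T = T ∩ B₀ ∪ B₁ := by
      ext x
      constructor
      · intro hx
        rcases Finset.mem_union.mp (hsub hx) with h | h
        · exact Finset.mem_union_left _ (Finset.mem_inter.mpr ⟨hx, h⟩)
        · exact Finset.mem_union_right _ h
      · intro hx
        rcases Finset.mem_union.mp hx with h | h
        · exact (Finset.mem_inter.mp h).1
        · exact hB1 h
    have hdS : Disjoint (T ∩ B₀) B₁ := hd.mono_left Finset.inter_subset_right
    have hScard : (T ∩ B₀).card = i := by
      have := Finset.card_union_of_disjoint hdS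
      rw [← hT, hcard, h1] at this; omega
    have hq1' : (B₀ \ T).card = n - i := by
      rw [show B₀ \ T = B₀ \ (T ∩ B₀) by
        ext x; simp only [Finset.mem_sdiff, Finset.mem_inter]; tauto,
        Finset.card_sdiff_of_subset Finset.inter_subset_right, h0, hScard]
    have hi : i < n := by omega
    rw [if_pos ⟨hi, by omega⟩, Finset.mem_image]
    exact ⟨T ∩ B₀, Finset.mem_powersetCard.mpr ⟨Finset.inter_subset_right, hScard⟩, hT.symm⟩
  · intro hT
    split_ifs at hT with hc
    · obtain ⟨S, hS, rfl⟩ := Finset.mem_image.mp hT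
      rw [Finset.mem_powersetCard] at hS
      have hdS : Disjoint S B₁ := hd.mono_left hS.1
      refine ⟨Finset.union_subset_union hS.1 (subset_refl _), ?_, ?_, Or.inr Finset.subset_union_right⟩
      · rw [Finset.card_union_of_disjoint hdS, hS.2, h1]
      · rw [show B₀ \ (S ∪ B₁) = B₀ \ S by
          rw [Finset.sdiff_union_distrib, Finset.sdiff_eq_self_of_disjoint hd, Finset.inter_eq_left]
          exact Finset.sdiff_subset,
          Finset.card_sdiff_of_subset hS.1, h0, hS.2, hc.2]
    · exact absurd hT (Finset.notMem_empty T)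

/-- **ONE-FACTOR COUNT**: `|factorReach B₀ B₁ n i q₁| = qAtom n i q₁ = [tⁱ u^{q₁}] Q_n(t,u)` — th-6's u-refined point atom. -/
theorem card_factorReach (hd : Disjoint B₀ B₁) (h0 : B₀.card = n) (h1 : B₁.card = n) (i q₁ : ℕ) :
    (factorReach B₀ B₁ n i q₁).card = qAtom n i q₁ := by
  rcases Nat.eq_zero_or_pos q₁ with rfl | hq
  · rw [factorReach_zero hd h0, Finset.card_image_of_injOn, Finset.card_powersetCard, h1, qAtom]
    · have : ¬ (i < n ∧ 0 = n - i) := by omega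
      rw [if_pos rfl, if_neg this, add_zero]
    · intro S hS S' hS' h
      have hS1 := (Finset.mem_powersetCard.mp (Finset.mem_coe.mp hS)).1
      have hS'1 := (Finset.mem_powersetCard.mp (Finset.mem_coe.mp hS')).1
      have e : (B₀ ∪ S) \ B₀ = (B₀ ∪ S') \ B₀ := by rw [show B₀ ∪ S = B₀ ∪ S' from h]
      rwa [Finset.union_sdiff_cancel_left (hd.mono_right hS1),
        Finset.union_sdiff_cancel_left (hd.mono_right hS'1)] at e
  · rw [factorReach_pos hd h0 h1 hq, qAtom, if_neg (by omega : q₁ ≠ 0), zero_add]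
    split_ifs with hc
    · rw [Finset.card_image_of_injOn, Finset.card_powersetCard, h0]
      intro S hS S' hS' h
      have hS1 := (Finset.mem_powersetCard.mp (Finset.mem_coe.mp hS)).1
      have hS'1 := (Finset.mem_powersetCard.mp (Finset.mem_coe.mp hS')).1
      have e : (S ∪ B₁) \ B₁ = (S' ∪ B₁) \ B₁ := by rw [show S ∪ B₁ = S' ∪ B₁ from h]
      rwa [Finset.union_sdiff_cancel_right (hd.mono_left hS1),
        Finset.union_sdiff_cancel_right (hd.mono_left hS'1)] at e
    · rfl

end FactorCount

/-! ## §2. The Künneth factorisation of `reach` and its count -/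

section Count

variable {n : ℕ}

/-- the factor-1 generators `X ∪ Y`. -/
def F1 (n : ℕ) : Finset (I n) := A n 0 ∪ A n 1

/-- the factor-2 generators `X′ ∪ Y′`. -/
def F2 (n : ℕ) : Finset (I n) := C n 0 ∪ C n 1

/-- the two factors are disjoint. -/
lemma disjoint_F1_F2 : Disjoint (F1 n) (F2 n) := by
  rw [F1, F2, Finset.disjoint_union_left, Finset.disjoint_union_right, Finset.disjoint_union_right]
  exact ⟨⟨disjoint_A_C n 0 0, disjoint_A_C n 0 1⟩, disjoint_A_C n 1 0, disjoint_A_C n 1 1⟩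

/-- each factor-1 block lies in `F1`. -/
lemma A_subset_F1 (α : Fin 2) : A n α ⊆ F1 n := by
  have : α = 0 ∨ α = 1 := by omega
  rcases this with rfl | rfl
  · exact Finset.subset_union_left
  · exact Finset.subset_union_right

/-- each factor-2 block lies in `F2`. -/
lemma C_subset_F2 (β : Fin 2) : C n β ⊆ F2 n := by
  have : β = 0 ∨ β = 1 := by omega
  rcases this with rfl | rfl
  · exact Finset.subset_union_left
  · exact Finset.subset_union_right

/-- `A α ⊆ T` for some `α` means `A 0 ⊆ T` or `A 1 ⊆ T`. -/
lemma or_of_A_subset {α : Fin 2} {T : Finset (I n)} (h : A n α ⊆ T) : A n 0 ⊆ T ∨ A n 1 ⊆ T := by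
  have : α = 0 ∨ α = 1 := by omega
  rcases this with rfl | rfl
  · exact Or.inl h
  · exact Or.inr h

/-- `C β ⊆ T` for some `β` means `C 0 ⊆ T` or `C 1 ⊆ T`. -/
lemma or_of_C_subset {β : Fin 2} {T : Finset (I n)} (h : C n β ⊆ T) : C n 0 ⊆ T ∨ C n 1 ⊆ T := by
  have : β = 0 ∨ β = 1 := by omega
  rcases this with rfl | rfl
  · exact Or.inl h
  · exact Or.inr h

/-- every generator lies in one of the two factors. -/
lemma mem_F1_or_mem_F2 (x : I n) : x ∈ F1 n ∨ x ∈ F2 n := by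
  rcases mem_cover n x with ⟨α, h⟩ | ⟨β, h⟩
  · exact Or.inl (A_subset_F1 α h)
  · exact Or.inr (C_subset_F2 β h)

/-- `T = (T ∩ F1) ∪ (T ∩ F2)`. -/
lemma inter_F1_union_inter_F2 (T : Finset (I n)) : T ∩ F1 n ∪ T ∩ F2 n = T := by
  ext x
  simp only [Finset.mem_union, Finset.mem_inter]
  constructor
  · rintro (⟨h, -⟩ | ⟨h, -⟩) <;> exact h
  · intro h
    rcases mem_F1_or_mem_F2 x with h' | h'
    · exact Or.inl ⟨h, h'⟩
    · exact Or.inr ⟨h, h'⟩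

/-- `X ∖ T` only sees the factor-1 part of `T`. -/
lemma A0_sdiff_eq (T : Finset (I n)) : A n 0 \ T = A n 0 \ (T ∩ F1 n) := by
  ext x
  simp only [Finset.mem_sdiff, Finset.mem_inter, F1, Finset.mem_union, not_and]
  constructor
  · rintro ⟨hx, hT⟩; exact ⟨hx, fun h _ => hT h⟩
  · rintro ⟨hx, h⟩; exact ⟨hx, fun hT => h hT (Or.inl hx)⟩

/-- `X′ ∖ T` only sees the factor-2 part of `T`. -/
lemma C0_sdiff_eq (T : Finset (I n)) : C n 0 \ T = C n 0 \ (T ∩ F2 n) := by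
  ext x
  simp only [Finset.mem_sdiff, Finset.mem_inter, F2, Finset.mem_union, not_and]
  constructor
  · rintro ⟨hx, hT⟩; exact ⟨hx, fun h _ => hT h⟩
  · rintro ⟨hx, h⟩; exact ⟨hx, fun hT => h hT (Or.inl hx)⟩

/-- `qdeg` is additive over the two factors (the Künneth sum `q = q₁ + q₂`). -/
lemma qdeg_eq_add (T : Finset (I n)) : qdeg n T = (A n 0 \ (T ∩ F1 n)).card + (C n 0 \ (T ∩ F2 n)).card := by
  rw [qdeg, show P n 0 0 = A n 0 ∪ C n 0 from rfl, Finset.union_sdiff_distrib, Finset.card_union_of_disjoint,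
    A0_sdiff_eq, C0_sdiff_eq]
  exact (disjoint_A_C n 0 0).mono Finset.sdiff_subset Finset.sdiff_subset

/-- the Künneth index set: `(i, j)` with `i + j = k` and `(q₁, q₂)` with `q₁ + q₂ = q`. -/
abbrev KIdx (k q : ℕ) : Finset ((ℕ × ℕ) × (ℕ × ℕ)) := antidiagonal k ×ˢ antidiagonal q

/-- the product pieces `factorReach₁(i, q₁) × factorReach₂(j, q₂)`. -/
def piece (n : ℕ) (x : (ℕ × ℕ) × (ℕ × ℕ)) : Finset (Finset (I n) × Finset (I n)) :=
  factorReach (A n 0) (A n 1) n x.1.1 x.2.1 ×ˢ factorReach (C n 0) (C n 1) n x.1.2 x.2.2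

/-- **KÜNNETH FACTORISATION**: `T ↦ (T ∩ F1, T ∩ F2)` maps `reach n k q` onto the disjoint union of the product pieces. -/
theorem image_reach_eq_biUnion (k q : ℕ) :
    (reach n k q).image (fun T => (T ∩ F1 n, T ∩ F2 n)) = (KIdx k q).biUnion (piece n) := by
  ext ⟨T₁, T₂⟩
  simp only [Finset.mem_image, Finset.mem_biUnion, piece, Finset.mem_product, Prod.mk.injEq, KIdx,
    Finset.HasAntidiagonal.mem_antidiagonal, Prod.exists]
  constructor
  · rintro ⟨T, hT, rfl, rfl⟩
    obtain ⟨hcard, hq, α, β, hP⟩ := mem_reach.mp hT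
    have hAsub : A n α ⊆ T ∩ F1 n := fun x hx =>
      Finset.mem_inter.mpr ⟨hP (Finset.mem_union_left _ hx), A_subset_F1 α hx⟩
    have hCsub : C n β ⊆ T ∩ F2 n := fun x hx =>
      Finset.mem_inter.mpr ⟨hP (Finset.mem_union_right _ hx), C_subset_F2 β hx⟩
    have h1n : n ≤ (T ∩ F1 n).card := by
      have := Finset.card_le_card hAsub; rwa [card_A] at this
    have h2n : n ≤ (T ∩ F2 n).card := by
      have := Finset.card_le_card hCsub; rwa [card_C] at this
    have hsum : (T ∩ F1 n).card + (T ∩ F2 n).card = k + (n + n) := by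
      rw [← Finset.card_union_of_disjoint (disjoint_F1_F2.mono Finset.inter_subset_right Finset.inter_subset_right),
        inter_F1_union_inter_F2, hcard]
    rw [qdeg_eq_add] at hq
    refine ⟨(T ∩ F1 n).card - n, (T ∩ F2 n).card - n, (A n 0 \ (T ∩ F1 n)).card, (C n 0 \ (T ∩ F2 n)).card,
      ⟨by omega, hq⟩, ?_, ?_⟩
    · rw [mem_factorReach]
      exact ⟨fun x hx => (Finset.mem_inter.mp hx).2, by omega, rfl, or_of_A_subset hAsub⟩
    · rw [mem_factorReach]
      exact ⟨fun x hx => (Finset.mem_inter.mp hx).2, by omega, rfl, or_of_C_subset hCsub⟩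
  · rintro ⟨i, j, q₁, q₂, ⟨hij, hq⟩, hT₁, hT₂⟩
    rw [mem_factorReach] at hT₁ hT₂
    obtain ⟨hsub₁, hcard₁, hq₁, hB₁⟩ := hT₁
    obtain ⟨hsub₂, hcard₂, hq₂, hB₂⟩ := hT₂
    have hsub₁' : T₁ ⊆ F1 n := hsub₁
    have hsub₂' : T₂ ⊆ F2 n := hsub₂
    have hd : Disjoint T₁ T₂ := disjoint_F1_F2.mono hsub₁' hsub₂'
    have e1 : (T₁ ∪ T₂) ∩ F1 n = T₁ := by
      rw [Finset.union_inter_distrib_right, Finset.inter_eq_left.mpr hsub₁',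
        Finset.disjoint_iff_inter_eq_empty.mp (disjoint_F1_F2.symm.mono_left hsub₂'), Finset.union_empty]
    have e2 : (T₁ ∪ T₂) ∩ F2 n = T₂ := by
      rw [Finset.union_inter_distrib_right, Finset.inter_eq_left.mpr hsub₂',
        Finset.disjoint_iff_inter_eq_empty.mp (disjoint_F1_F2.mono_left hsub₁'), Finset.empty_union]
    refine ⟨T₁ ∪ T₂, ?_, e1, e2⟩
    rw [mem_reach]
    refine ⟨by rw [Finset.card_union_of_disjoint hd, hcard₁, hcard₂]; omega, ?_, ?_⟩
    · rw [qdeg_eq_add, e1, e2, hq₁, hq₂, hq]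
    · -- a full block on each factor
      have hα : ∃ α, A n α ⊆ T₁ ∪ T₂ := by
        rcases hB₁ with h | h
        · exact ⟨0, h.trans Finset.subset_union_left⟩
        · exact ⟨1, h.trans Finset.subset_union_left⟩
      have hβ : ∃ β, C n β ⊆ T₁ ∪ T₂ := by
        rcases hB₂ with h | h
        · exact ⟨0, h.trans Finset.subset_union_right⟩
        · exact ⟨1, h.trans Finset.subset_union_right⟩
      obtain ⟨α, hα⟩ := hα
      obtain ⟨β, hβ⟩ := hβ
      exact ⟨α, β, Finset.union_subset hα hβ⟩

/-- the product pieces are pairwise disjoint (a pair `(T₁, T₂)` determines `i, j, q₁, q₂`). -/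
lemma pairwiseDisjoint_piece (k q : ℕ) : ((KIdx k q : Finset _) : Set ((ℕ × ℕ) × (ℕ × ℕ))).PairwiseDisjoint (piece n) := by
  intro x _ y _ hxy
  rw [Function.onFun, Finset.disjoint_left]
  rintro ⟨T₁, T₂⟩ hx hy
  simp only [piece, Finset.mem_product, mem_factorReach] at hx hy
  obtain ⟨⟨-, hc₁, hq₁, -⟩, -, hc₂, hq₂, -⟩ := hx
  obtain ⟨⟨-, hc₁', hq₁', -⟩, -, hc₂', hq₂', -⟩ := hy
  apply hxy
  ext <;> omega

/-- `T ↦ (T ∩ F1, T ∩ F2)` is injective. -/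
lemma inter_F1_F2_injective : Function.Injective fun T : Finset (I n) => (T ∩ F1 n, T ∩ F2 n) := by
  intro T T' h
  simp only [Prod.mk.injEq] at h
  rw [← inter_F1_union_inter_F2 T, ← inter_F1_union_inter_F2 T', h.1, h.2]

/-- **THE COUNT**: `|reach n k q| = blockCount n k q = Σ_{i+j=k} Σ_{q₁+q₂=q} qAtom n i q₁ · qAtom n j q₂` (`= [t^k u^q] Q_n(t,u)²`,
`FormulaNUniformBlocks.coeff_Q_sq`), for all `n, k, q`. -/
theorem card_reach (n k q : ℕ) : (reach n k q).card = blockCount n k q := by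
  rw [← Finset.card_image_of_injective _ inter_F1_F2_injective, image_reach_eq_biUnion,
    Finset.card_biUnion (pairwiseDisjoint_piece k q), blockCount, Finset.sum_product]
  refine Finset.sum_congr rfl fun ij _ => Finset.sum_congr rfl fun pq _ => ?_
  rw [piece, Finset.card_product,
    card_factorReach (disjoint_A_A n (by decide)) (card_A n 0) (card_A n 1),
    card_factorReach (disjoint_C_C n (by decide)) (card_C n 0) (card_C n 1)]

end Count

/-! ## §3. th-6's PER-q LAW in the wedge model -/

section PerQLaw

variable (K : Type*) [Field K] {n k : ℕ}

/-- **PER-q LAW (box class form)**: for `n ≥ 1`, `k ≥ 1`, all `c_{αβ} ≠ 0` and every `q`,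
`rank(blockProj q ∘ (θ ↦ θ ∧ boxClass c) ∣ ⋀^k K^{4n}) = blockCount n k q`. -/
theorem finrank_range_blockProj_wedgeMap (hn : 0 < n) (hk : 0 < k) {c : Fin 2 → Fin 2 → K}
    (hc : ∀ α β, c α β ≠ 0) (q : ℕ) :
    finrank K (LinearMap.range (blockProj K n q ∘ₗ wedgeMap K n k (boxClass K n c))) = blockCount n k q := by
  rw [finrank_range_blockProj_wedgeMap_eq_card K c hn hk hc q, card_reach]

/-- **PER-q LAW for the honest box `f₁ ∧ f₂`** (th-6 FORMULA-N PART A §4.1″, class side, in th-7's model): for every field `K`,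
`n ≥ 1`, `k ≥ 1`, `q`, and factor classes `f₁ = Σ a_α E_{Aα}`, `f₂ = Σ a′_β E_{Cβ}` with all `a_α, a′_β ≠ 0`,
`rank(blockProj q ∘ (θ ↦ θ ∧ (f₁ ∧ f₂)) ∣ ⋀^k K^{4n}) = blockCount n k q`. -/
theorem finrank_range_blockProj_wedgeMap_fac_mul (hn : 0 < n) (hk : 0 < k) {a a' : Fin 2 → K}
    (ha : ∀ α, a α ≠ 0) (ha' : ∀ β, a' β ≠ 0) (q : ℕ) :
    finrank K (LinearMap.range (blockProj K n q ∘ₗ wedgeMap K n k (fac1 K n a * fac2 K n a'))) = blockCount n k q := by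
  rw [fac1_mul_fac2]
  exact finrank_range_blockProj_wedgeMap K hn hk (boxCoeff_ne_zero K ha ha') q

/-- … `= [t^k u^q] Q_n(t,u)²`, `Q_n = (1+t)ⁿ + (u+t)ⁿ − tⁿ` (th-6's generating function; STRUCTURE C13 «IDENTIFIED v0.16»). -/
theorem finrank_range_blockProj_wedgeMap_eq_coeff_Q_sq (hn : 0 < n) (hk : 0 < k) {a a' : Fin 2 → K}
    (ha : ∀ α, a α ≠ 0) (ha' : ∀ β, a' β ≠ 0) (q : ℕ) :
    (finrank K (LinearMap.range (blockProj K n q ∘ₗ wedgeMap K n k (fac1 K n a * fac2 K n a'))) : ℤ) =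
      ((FormulaN.Uniform.Q n ^ 2).coeff k).coeff q := by
  rw [finrank_range_blockProj_wedgeMap_fac_mul K hn hk ha ha', FormulaN.Uniform.coeff_Q_sq]

/-! ## §4. Degree 2: STRUCTURE C13 as a kernel rank theorem, and the `n = 2, 3, 4` instances -/

/-- **C13, uniformly in `n`**: for every `n ≥ 3` and every `q`, the rank of the `q`-block of `θ ↦ θ ∧ (f₁ ∧ f₂)` on `⋀² K^{4n}`
is `sigmaBlockRank n q` — `2n² − n` at `q ∈ {0, 2n−2}`, `2n²` at `q = n−1`, `n² − n` at `q ∈ {n−2, n}`, `0` elsewhere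
(STRUCTURE §1.1 C13's closed form; th-7 Σ4; th-6 §4.1). -/
theorem finrank_range_blockProj_two_eq_sigmaBlockRank (hn : 3 ≤ n) {a a' : Fin 2 → K}
    (ha : ∀ α, a α ≠ 0) (ha' : ∀ β, a' β ≠ 0) (q : ℕ) :
    finrank K (LinearMap.range (blockProj K n q ∘ₗ wedgeMap K n 2 (fac1 K n a * fac2 K n a'))) =
      FormulaN.Uniform.sigmaBlockRank n q := by
  rw [finrank_range_blockProj_wedgeMap_fac_mul K (by omega) (by omega) ha ha',
    FormulaN.Uniform.blockCount_two_eq_sigmaBlockRank hn]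

/-- **THE `n = 2, 3, 4` INSTANCES** (kernel): the degree-2 block-rank vectors `q ↦ rank(blockProj q ∘ (θ ↦ θ ∧ (f₁ ∧ f₂)) ∣ ⋀²)`
on `⋀²K⁸`, `⋀²K^{12}`, `⋀²K^{16}` are `(6, 8, 6)`, `(15, 6, 18, 6, 15)`, `(28, 0, 12, 32, 12, 0, 28)` — STEP-0's signed `(6,8,6)`
at `g = 4`, engine-1's `(15,6,18,6,15)` at `g = 6` («MEASURED = PREDICTED TO THE DIGIT»), the `g = 8` row of STRUCTURE C13. -/
theorem instances_blockRank_two {a a' : Fin 2 → K} (ha : ∀ α, a α ≠ 0) (ha' : ∀ β, a' β ≠ 0) :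
    (List.range 3).map (fun q => finrank K (LinearMap.range
        (blockProj K 2 q ∘ₗ wedgeMap K 2 2 (fac1 K 2 a * fac2 K 2 a')))) = [6, 8, 6] ∧
    (List.range 5).map (fun q => finrank K (LinearMap.range
        (blockProj K 3 q ∘ₗ wedgeMap K 3 2 (fac1 K 3 a * fac2 K 3 a')))) = [15, 6, 18, 6, 15] ∧
    (List.range 7).map (fun q => finrank K (LinearMap.range
        (blockProj K 4 q ∘ₗ wedgeMap K 4 2 (fac1 K 4 a * fac2 K 4 a')))) = [28, 0, 12, 32, 12, 0, 28] := by
  have e : ∀ (m : ℕ) (L : List ℕ), 0 < m →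
      L.map (fun q => finrank K (LinearMap.range
        (blockProj K m q ∘ₗ wedgeMap K m 2 (fac1 K m a * fac2 K m a')))) = L.map (blockCount m 2) := by
    intro m L hm
    refine List.map_congr_left fun q _ => ?_
    exact finrank_range_blockProj_wedgeMap_fac_mul K hm (by omega) ha ha' q
  rw [e 2 _ (by omega), e 3 _ (by omega), e 4 _ (by omega)]
  decide

end PerQLaw

end Summit.Ventures.HSemireg.WedgeBox
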